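import Mathlib
import Summits.Ventures.PercRepro2.MixChordOStarPins

/-!
# The four worlds of the `o`–ROOT STAR: the `Q`-events world by world (blind cell PercRepro2, night-1 g24;
proofs/NIGHT1-G24.md §3)

For an `a₃`-free `X` (the readings of MixChordOStarPins.lean as hypotheses), the probabilities of `Q ∩ X`, `PD ∩ X`, `T ∩ X`, `T′ ∩ X` in the
four worlds of the star read on the base instance `p₀₀ = p[g ↦ 0][e ↦ 0]`:

* world `(0, 0)` (`a₃` isolated): `PD = Q`, `T = T′ = ∅` (`prob_PD_00`, `prob_T_00`, `prob_T'_00`);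
* world `(1, 0)` (`a₃` a leaf at `o`): every event reads with `a₃ := o` (`prob_Q_10`, `prob_PD_10`,
  `prob_T_10`, `prob_T'_10`);
* world `(0, 1)` (`a₃ ≡ a₁`): `PD = T = ∅`, `T′ = Q` (`prob_Q_01`, `prob_PD_01`, `prob_T_01`, `prob_T'_01`);
* world `(1, 1)` (`a₃ ≡ a₁ ≡ o`): `PD = T = ∅`, `T′ = Q`, and the events read on `p₀₀[f ↦ 1]` — the base
  instance with the `o`-edge OPENED (`prob_Q_11`, `prob_PD_11`, `prob_T_11`, `prob_T'_11`).

The `X = univ` versions, the two-pin mixture and the `o`-instance bookkeeping are in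
MixChordOStarWorldsUniv.lean.  Own code; standard axioms.
-/

namespace Summit.Ventures.PercRepro2

open UnionCluster CovForm

namespace Mix

namespace OStar

/-! ## The probabilities of `Q ∩ X`, `PD ∩ X`, `T ∩ X`, `T′ ∩ X` in the four worlds (`X` `a₃`-free) -/

section Worlds

variable {V : Type*} {E : Type*} [Fintype E] [DecidableEq E] {R : Type*} [Field R]

variable (p : E → R) {ends : E → Sym2 V} {g e f : E} {o a₁ a₂ a₃ : V}
  (hg : ends g = s(a₃, o)) (he : ends e = s(a₃, a₁))
  (hstar : ∀ e', a₃ ∈ ends e' → e' = g ∨ e' = e) (hf : ends f = s(o, a₁))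
  (hge : g ≠ e) (hgf : g ≠ f) (hef : e ≠ f) (h13 : a₁ ≠ a₃) (h23 : a₂ ≠ a₃) (ho3 : o ≠ a₃)
  {X : Set (Config E)} (hX : (∀ ω : Config E,
      (Function.update (Function.update ω g true) e false ∈ X ↔
          Function.update (Function.update ω g false) e false ∈ X) ∧
      (Function.update (Function.update ω g false) e true ∈ X ↔
          Function.update (Function.update ω g false) e false ∈ X))) (hXf : (∀ ω : Config E,
      Function.update (Function.update ω g true) e true ∈ X ↔
        Function.update (Function.update (Function.update ω g false) e false) f true ∈ X))

/-! ### World `(1, 0)`: `a₃` a leaf at `o` — every event reads with `a₃ := o` -/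

include hg hstar hge h13 h23 hX in
/-- `Q ∩ X` in world `(1, 0)` (`a₃` a leaf at `o`). -/
lemma prob_Q_10 :
    prob (Function.update (Function.update p g 1) e 0) (avoidAll ends a₂ {a₁} ∩ X) =
      prob (Function.update (Function.update p g 0) e 0) (avoidAll ends a₂ {a₁} ∩ X) := by
  rw [prob_w10, prob_w00]
  congr 1
  ext ω
  obtain ⟨h1, -⟩ := hX ω
  simp only [Set.mem_setOf_eq, Set.mem_inter_iff, mem_Q_iff, h1, r10 hg hstar hge ω h23 h13]

include hg hstar hge h13 h23 hX in
/-- `PD ∩ X` in world `(1, 0)` (`a₃` a leaf at `o`). -/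
lemma prob_PD_10 :
    prob (Function.update (Function.update p g 1) e 0) (PDEvent ends a₁ a₂ a₃ ∩ X) =
      prob (Function.update (Function.update p g 0) e 0) (PDEvent ends a₁ a₂ o ∩ X) := by
  rw [prob_w10, prob_w00]
  congr 1
  ext ω
  obtain ⟨h1, -⟩ := hX ω
  simp only [Set.mem_setOf_eq, Set.mem_inter_iff, mem_PD_iff, h1, r10 hg hstar hge ω h13 h23,
    r10a' hg hstar hge ω h13, r10a' hg hstar hge ω h23]

include hg hstar hge h13 h23 hX in
/-- `T ∩ X` in world `(1, 0)` (`a₃` a leaf at `o`). -/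
lemma prob_T_10 :
    prob (Function.update (Function.update p g 1) e 0) (TEvent ends a₁ a₂ a₃ ∩ X) =
      prob (Function.update (Function.update p g 0) e 0) (TEvent ends a₁ a₂ o ∩ X) := by
  rw [prob_w10, prob_w00]
  congr 1
  ext ω
  obtain ⟨h1, -⟩ := hX ω
  simp only [Set.mem_setOf_eq, Set.mem_inter_iff, mem_T_iff, h1, r10 hg hstar hge ω h23 h13,
    r10a hg hstar hge ω h23]

include hg hstar hge h13 h23 hX in
/-- `T′ ∩ X` in world `(1, 0)` (`a₃` a leaf at `o`). -/
lemma prob_T'_10 :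
    prob (Function.update (Function.update p g 1) e 0) (TEvent ends a₂ a₁ a₃ ∩ X) =
      prob (Function.update (Function.update p g 0) e 0) (TEvent ends a₂ a₁ o ∩ X) := by
  rw [prob_w10, prob_w00]
  congr 1
  ext ω
  obtain ⟨h1, -⟩ := hX ω
  simp only [Set.mem_setOf_eq, Set.mem_inter_iff, mem_T_iff, h1, r10 hg hstar hge ω h13 h23,
    r10a hg hstar hge ω h13]

/-! ### World `(0, 1)`: `a₃` a leaf at `a₁` with the edge open — `a₃ := a₁` -/

include he hstar hge h13 h23 hX in
/-- `Q ∩ X` in world `(0, 1)` (`a₃ ≡ a₁`). -/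
lemma prob_Q_01 :
    prob (Function.update (Function.update p g 0) e 1) (avoidAll ends a₂ {a₁} ∩ X) =
      prob (Function.update (Function.update p g 0) e 0) (avoidAll ends a₂ {a₁} ∩ X) := by
  rw [prob_w01, prob_w00]
  congr 1
  ext ω
  obtain ⟨-, h2⟩ := hX ω
  simp only [Set.mem_setOf_eq, Set.mem_inter_iff, mem_Q_iff, h2, r01 he hstar hge ω h23 h13]

include he hstar hge h13 in
/-- `PD ∩ X` in world `(0, 1)` (`a₃ ≡ a₁`). -/
lemma prob_PD_01 :
    prob (Function.update (Function.update p g 0) e 1) (PDEvent ends a₁ a₂ a₃ ∩ X) = 0 := by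
  rw [prob_w01]
  have hempty : {ω : Config E |
      Function.update (Function.update ω g false) e true ∈ PDEvent ends a₁ a₂ a₃ ∩ X} = ∅ := by
    ext ω
    simp only [Set.mem_setOf_eq, Set.mem_inter_iff, mem_PD_iff, r01a' he hstar hge ω h13,
      Set.mem_empty_iff_false, iff_false]
    rintro ⟨⟨-, h, -⟩, -⟩
    exact h (conn_refl _ _ _)
  rw [hempty, prob_empty]

include he hstar hge h13 h23 in
/-- `T ∩ X` in world `(0, 1)` (`a₃ ≡ a₁`). -/
lemma prob_T_01 :
    prob (Function.update (Function.update p g 0) e 1) (TEvent ends a₁ a₂ a₃ ∩ X) = 0 := by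
  rw [prob_w01]
  have hempty : {ω : Config E |
      Function.update (Function.update ω g false) e true ∈ TEvent ends a₁ a₂ a₃ ∩ X} = ∅ := by
    ext ω
    simp only [Set.mem_setOf_eq, Set.mem_inter_iff, mem_T_iff, r01 he hstar hge ω h23 h13,
      r01a he hstar hge ω h23, Set.mem_empty_iff_false, iff_false]
    rintro ⟨⟨h, h'⟩, -⟩
    exact h h'
  rw [hempty, prob_empty]

include he hstar hge h13 h23 hX in
/-- `T′ ∩ X` in world `(0, 1)` (`a₃ ≡ a₁`). -/
lemma prob_T'_01 :
    prob (Function.update (Function.update p g 0) e 1) (TEvent ends a₂ a₁ a₃ ∩ X) =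
      prob (Function.update (Function.update p g 0) e 0) (avoidAll ends a₂ {a₁} ∩ X) := by
  rw [prob_w01, prob_w00]
  congr 1
  ext ω
  obtain ⟨-, h2⟩ := hX ω
  simp only [Set.mem_setOf_eq, Set.mem_inter_iff, mem_T_iff, mem_Q_iff', h2,
    r01 he hstar hge ω h13 h23, r01a he hstar hge ω h13, conn_refl, and_true]

/-! ### World `(1, 1)`: `a₃ := a₁` and the `o`-edge opened -/

include hg he hstar hf hge hgf hef h13 h23 hXf in
/-- `Q ∩ X` in world `(1, 1)` (`a₃ ≡ a₁ ≡ o`, read with the `o`-edge opened). -/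
lemma prob_Q_11 :
    prob (Function.update (Function.update p g 1) e 1) (avoidAll ends a₂ {a₁} ∩ X) =
      prob (Function.update (Function.update (Function.update p g 0) e 0) f 1)
        (avoidAll ends a₂ {a₁} ∩ X) := by
  rw [prob_w11, prob_w00f]
  congr 1
  ext ω
  have h3 := hXf ω
  simp only [Set.mem_setOf_eq, Set.mem_inter_iff, mem_Q_iff, h3,
    r11 hg he hstar hf hge hgf hef ω h23 h13]

include hg he hstar hf hge hgf hef h13 in
/-- `PD ∩ X` in world `(1, 1)` (`a₃ ≡ a₁ ≡ o`, read with the `o`-edge opened). -/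
lemma prob_PD_11 :
    prob (Function.update (Function.update p g 1) e 1) (PDEvent ends a₁ a₂ a₃ ∩ X) = 0 := by
  rw [prob_w11]
  have hempty : {ω : Config E |
      Function.update (Function.update ω g true) e true ∈ PDEvent ends a₁ a₂ a₃ ∩ X} = ∅ := by
    ext ω
    simp only [Set.mem_setOf_eq, Set.mem_inter_iff, mem_PD_iff,
      r11a' hg he hstar hf hge hgf hef h13.symm ω h13, Set.mem_empty_iff_false, iff_false]
    rintro ⟨⟨-, h, -⟩, -⟩
    exact h (conn_refl _ _ _)
  rw [hempty, prob_empty]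

include hg he hstar hf hge hgf hef h13 h23 in
/-- `T ∩ X` in world `(1, 1)` (`a₃ ≡ a₁ ≡ o`, read with the `o`-edge opened). -/
lemma prob_T_11 :
    prob (Function.update (Function.update p g 1) e 1) (TEvent ends a₁ a₂ a₃ ∩ X) = 0 := by
  rw [prob_w11]
  have hempty : {ω : Config E |
      Function.update (Function.update ω g true) e true ∈ TEvent ends a₁ a₂ a₃ ∩ X} = ∅ := by
    ext ω
    simp only [Set.mem_setOf_eq, Set.mem_inter_iff, mem_T_iff,
      r11 hg he hstar hf hge hgf hef ω h23 h13, r11a hg he hstar hf hge hgf hef h13.symm ω h23,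
      Set.mem_empty_iff_false, iff_false]
    rintro ⟨⟨h, h'⟩, -⟩
    exact h h'
  rw [hempty, prob_empty]

include hg he hstar hf hge hgf hef h13 h23 hXf in
/-- `T′ ∩ X` in world `(1, 1)` (`a₃ ≡ a₁ ≡ o`, read with the `o`-edge opened). -/
lemma prob_T'_11 :
    prob (Function.update (Function.update p g 1) e 1) (TEvent ends a₂ a₁ a₃ ∩ X) =
      prob (Function.update (Function.update (Function.update p g 0) e 0) f 1)
        (avoidAll ends a₂ {a₁} ∩ X) := by
  rw [prob_w11, prob_w00f]
  congr 1
  ext ω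
  have h3 := hXf ω
  simp only [Set.mem_setOf_eq, Set.mem_inter_iff, mem_T_iff, mem_Q_iff', h3,
    r11 hg he hstar hf hge hgf hef ω h13 h23, r11a hg he hstar hf hge hgf hef h13.symm ω h13,
    conn_refl, and_true]

/-! ### World `(0, 0)`: `a₃` isolated -/

include hstar hge h13 h23 in
/-- `PD ∩ X` in world `(0, 0)` (`a₃` isolated). -/
lemma prob_PD_00 :
    prob (Function.update (Function.update p g 0) e 0) (PDEvent ends a₁ a₂ a₃ ∩ X) =
      prob (Function.update (Function.update p g 0) e 0) (avoidAll ends a₂ {a₁} ∩ X) := by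
  rw [prob_w00, prob_w00]
  congr 1
  ext ω
  simp only [Set.mem_setOf_eq, Set.mem_inter_iff, mem_PD_iff, mem_Q_iff', r00a' hstar hge ω h13,
    r00a' hstar hge ω h23, not_false_eq_true, and_true]

include hstar hge h23 in
/-- `T ∩ X` in world `(0, 0)` (`a₃` isolated). -/
lemma prob_T_00 :
    prob (Function.update (Function.update p g 0) e 0) (TEvent ends a₁ a₂ a₃ ∩ X) = 0 := by
  rw [prob_w00]
  have hempty : {ω : Config E |
      Function.update (Function.update ω g false) e false ∈ TEvent ends a₁ a₂ a₃ ∩ X} = ∅ := by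
    ext ω
    simp only [Set.mem_setOf_eq, Set.mem_inter_iff, mem_T_iff, r00a hstar hge ω h23,
      Set.mem_empty_iff_false, and_false, false_and]
  rw [hempty, prob_empty]

include hstar hge h13 in
/-- `T′ ∩ X` in world `(0, 0)` (`a₃` isolated). -/
lemma prob_T'_00 :
    prob (Function.update (Function.update p g 0) e 0) (TEvent ends a₂ a₁ a₃ ∩ X) = 0 := by
  rw [prob_w00]
  have hempty : {ω : Config E |
      Function.update (Function.update ω g false) e false ∈ TEvent ends a₂ a₁ a₃ ∩ X} = ∅ := by
    ext ω
    simp only [Set.mem_setOf_eq, Set.mem_inter_iff, mem_T_iff, r00a hstar hge ω h13,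
      Set.mem_empty_iff_false, and_false, false_and]
  rw [hempty, prob_empty]


end Worlds

end OStar

end Mix

end Summit.Ventures.PercRepro2
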